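import Mathlib
import HarnessLib
import Summits.Ventures.LatticeQCDFlow.Exactness.ApproxDilationAlgebra
import Summits.Ventures.LatticeQCDFlow.Exactness.LocalDilationPushforward

/-!
# An approximate identity has a local inverse on a ball, which is again an approximate identity

HONEST FRAMING: exact (Metropolis-corrected) sampling algorithms for lattice gauge theory;
figures of merit are autocorrelation/cost numbers at stated couplings and volumes; no
continuum-physics claim.

Venture `LatticeQCDFlow` (cell pub-lqcd), topic `Exactness`, FANOUT row 9 (eng-latcore; roadmap Step 3 glue to
multi-step HMC on the `cpn_2d` sphere family, HOME/eng-latcore/HANDOFF.md GEN-19 — route (β): the exponential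
coordinate of the trajectory is the INVERSE flat chart of the tangent readout).  NEW WORK of the cell over the tree
(gen-18's `LocalDilationPushforward.lean`: `surjOn_closedBall_of_approxOn` — an approximate dilation covers a ball;
`ApproxDilationAlgebra.lean`: `approx_inverse`, `approx_comp`) and Mathlib (choice); nothing is cited as a fact;
no number.

* **`exists_local_inverse_of_approx`** — if `κ : V → V` (finite-dimensional real normed space `V`) satisfies
  `‖κ y − κ y' − (y − y')‖ ≤ η‖y − y'‖` on `closedBall 0 R` with `0 ≤ η < 1`, then there is `g : V → V` with
  `κ (g z) = z` and `g z ∈ closedBall 0 R` for every `z ∈ closedBall (κ 0) ((1 − η) R)`, and `g` is an approximate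
  identity there with defect `η/(1 − η)`.
* **`approx_comp_inverse`** — composing an approximate dilation `Ψ` (by `τ`, defect `c`, values in that ball) with
  such a `g` gives an approximate dilation by `τ` with defect `c + (η/(1−η))(τ + c)`.

NOT CLAIMED: uniqueness / continuity / measurability of `g` (not needed for the preimage-form volume bound, where
only `κ ∘ g = id` on the ball is used), anything sphere-specific.
-/

noncomputable section

namespace Summit.Ventures.LatticeQCDFlow.Exactness

open Set Metric

variable {V : Type*} [NormedAddCommGroup V] [NormedSpace ℝ V] [FiniteDimensional ℝ V]

/-- **Local inverse of an approximate identity.** -/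
theorem exists_local_inverse_of_approx {κ : V → V} {η R : ℝ} (hη0 : 0 ≤ η) (hη1 : η < 1) (hR : 0 ≤ R)
    (hκ : ∀ y ∈ closedBall (0 : V) R, ∀ y' ∈ closedBall (0 : V) R, ‖κ y - κ y' - (y - y')‖ ≤ η * ‖y - y'‖) :
    ∃ g : V → V, (∀ z ∈ closedBall (κ 0) ((1 - η) * R), κ (g z) = z ∧ g z ∈ closedBall (0 : V) R) ∧
      ∀ z ∈ closedBall (κ 0) ((1 - η) * R), ∀ z' ∈ closedBall (κ 0) ((1 - η) * R),
        ‖g z - g z' - (z - z')‖ ≤ η / (1 - η) * ‖z - z'‖ := by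
  -- the approximate identity is an approximate dilation by `τ = 1`
  have hκ1 : ∀ y ∈ closedBall (0 : V) R, ∀ y' ∈ closedBall (0 : V) R,
      ‖κ y - κ y' - (1 : ℝ) • (y - y')‖ ≤ η * ‖y - y'‖ :=
    fun y hy y' hy' => by rw [one_smul]; exact hκ y hy y' hy'
  have hsurj := surjOn_closedBall_of_approxOn hη1 hη0 hR hκ1
  classical
  -- choose a preimage in the ball for points of the target ball, anything elsewhere
  let g : V → V := fun z => if hz : z ∈ closedBall (κ 0) ((1 - η) * R) then (hsurj hz).choose else 0
  have hg : ∀ z ∈ closedBall (κ 0) ((1 - η) * R), κ (g z) = z ∧ g z ∈ closedBall (0 : V) R := by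
    intro z hz
    have hspec := (hsurj hz).choose_spec
    simp only [g, dif_pos hz]
    exact ⟨hspec.2, hspec.1⟩
  refine ⟨g, hg, fun z hz z' hz' => ?_⟩
  exact approx_inverse (S := closedBall (0 : V) R) (T := closedBall (κ 0) ((1 - η) * R)) hη0 hη1 hκ
    (fun w hw => (hg w hw).2) (fun w hw => (hg w hw).1) hz hz'

omit [FiniteDimensional ℝ V] in
/-- **Approximate dilation followed by the local inverse of an approximate identity** is an approximate dilation
with defect `c + (η/(1−η))(τ + c)`, provided `Ψ` maps the momentum set into the ball where `g` inverts `κ`. -/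
theorem approx_comp_inverse {κ g Ψ : V → V} {η R τ c : ℝ} {S : Set V} (hη0 : 0 ≤ η) (hη1 : η < 1) (hτ : 0 ≤ τ)
    (hκ : ∀ y ∈ closedBall (0 : V) R, ∀ y' ∈ closedBall (0 : V) R, ‖κ y - κ y' - (y - y')‖ ≤ η * ‖y - y'‖)
    (hg : ∀ z ∈ closedBall (κ 0) ((1 - η) * R), κ (g z) = z ∧ g z ∈ closedBall (0 : V) R)
    (hΨ : ∀ p ∈ S, ∀ p' ∈ S, ‖Ψ p - Ψ p' - τ • (p - p')‖ ≤ c * ‖p - p'‖)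
    (hΨS : MapsTo Ψ S (closedBall (κ 0) ((1 - η) * R))) {p p' : V} (hp : p ∈ S) (hp' : p' ∈ S) :
    ‖g (Ψ p) - g (Ψ p') - τ • (p - p')‖ ≤ (c + η / (1 - η) * (τ + c)) * ‖p - p'‖ := by
  have hginv : ∀ z ∈ closedBall (κ 0) ((1 - η) * R), ∀ z' ∈ closedBall (κ 0) ((1 - η) * R),
      ‖g z - g z' - (z - z')‖ ≤ η / (1 - η) * ‖z - z'‖ := fun z hz z' hz' =>
    approx_inverse (S := closedBall (0 : V) R) (T := closedBall (κ 0) ((1 - η) * R)) hη0 hη1 hκ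
      (fun w hw => (hg w hw).2) (fun w hw => (hg w hw).1) hz hz'
  have hη' : 0 ≤ η / (1 - η) := div_nonneg hη0 (by linarith)
  exact approx_comp hτ hη' hΨ hginv hΨS hp hp'

end Summit.Ventures.LatticeQCDFlow.Exactness
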